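import Mathlib
import Summits.KontsevichZagierPeriods.KontsevichZagierPeriods.Theorems.TorsionLogsGKZLevelThreePairTChainCubeRootB
import Summits.KontsevichZagierPeriods.KontsevichZagierPeriods.Theorems.TorsionLogsGKZLevelThreePairBetaDisc
import Literature.NumberTheory.Transcendental.KZCalculus
import Literature.NumberTheory.Transcendental.KZLogCalculusProofs
import Literature.NumberTheory.Transcendental.KZDominatedFamilyRelations
import Literature.NumberTheory.Transcendental.KZSemialgebraicComplex
import Literature.NumberTheory.Transcendental.SemialgebraicMapsProofs
import Literature.NumberTheory.Transcendental.SemialgebraicRpow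
import Literature.NumberTheory.Transcendental.EllIterRep
import Literature.NumberTheory.Transcendental.KZRelationsLE

/-!
# Route TorsionLogs — support item `GKZLevelThreePair`: the Clausen reduction, II
# (`(4/√3)·Trep ∼ T₂ = [(0,1)² ∋ (w,τ), (2/√3)·τ^{-1/3}(1-τ)^{-2/3}(1-wτ)^{-1/3} w^{-1/2}]`)

Helper file for item `stmt-KontsevichZagierPeriods-13812` (`GKZLevelThreePair`), blueprint v3 step (M).
After the move `cube_sqrtChart_equivalent` the right-hand side of the product formula is the
product `[(0,1), (1-v²)^{-1/2}] × T₂`; this file identifies the second factor with the Euler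
representation `Trep` of the T-chain, scaled by the algebraic constant `4/√3`, by the change of
variables `(t,y) ↦ (w,τ) = (y², t)` (rule (2), `|det| = 2y`, `w^{-1/2}·2y = 2`):

* `exists_rep_of_image` — a representation on `Φ '' D` from one on `D` (Jacobian transport);
* `hasFDerivAt_sqTimeChart`, `det_sqTimeChart`, `sqTimeChart_injOn`, `sqTimeChart_image`;
* `isAlgebraic_four_div_sqrt_three`;
* `exists_T2` — `T₂` exists and `(4/√3)·Trep ∼ T₂`.

## References

* M. Kontsevich, D. Zagier, *Periods* (2001), §1.2 rule (2).
-/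

-- `Summit.<Summit>.<Sub>` with Sub = Summit (single-conjunct summit, D-0017) duplicates the segment.
set_option linter.dupNamespace false

noncomputable section

namespace Summit.KontsevichZagierPeriods.KontsevichZagierPeriods.Theorems.GKZLevelThree

open Set MeasureTheory
open MvPolynomial (aeval X C)
open Literature.NumberTheory.Transcendental Literature.NumberTheory.Transcendental.KZ
open Literature.ModelTheory.ExponentialFields (IsSemialgebraic isSemialgebraic_setOf_eval_pos)

/-! ## Forward Jacobian transport -/

/-- A representation on `Φ '' D` with integrand `g` exists as soon as `r.integrand = (g ∘ Φ)·|det Φ'|`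
on `D = r.domain` for an injective differentiable map `Φ` (Mathlib's change-of-variables criterion
transports integrability forwards). [folklore] -/
theorem exists_rep_of_image {n : ℕ} (r : IntegralRep n) (Φ : (Fin n → ℝ) → (Fin n → ℝ))
    (Φ' : (Fin n → ℝ) → (Fin n → ℝ) →L[ℝ] (Fin n → ℝ))
    (hder : ∀ x ∈ r.domain, HasFDerivWithinAt Φ (Φ' x) r.domain x) (hinj : InjOn Φ r.domain)
    {S : Set (Fin n → ℝ)} (hS : IsSemialgebraic ℚ S) (himage : Φ '' r.domain = S)
    (g : (Fin n → ℝ) → ℝ) (hg : IsSemialgebraicFunOn ℚ S g)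
    (hint : ∀ x ∈ r.domain, r.integrand x = g (Φ x) * |(Φ' x).det|) :
    ∃ r' : IntegralRep n, r'.domain = S ∧ r'.integrand = g := by
  have hmeas : MeasurableSet r.domain := IntegralRep.measurableSet_domain_holds r
  have h : IntegrableOn g (Φ '' r.domain) := by
    rw [integrableOn_image_iff_integrableOn_abs_det_fderiv_smul volume hmeas hder hinj]
    exact r.integrableOn.congr_fun (fun x hx => by rw [hint x hx, smul_eq_mul, mul_comm]) hmeas
  rw [himage] at h
  exact ⟨⟨S, g, hS, hg, h⟩, rfl, rfl⟩

/-! ## The chart `(t,y) ↦ (y², t)` -/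

/-- Derivative of `(t,y) ↦ (y², t)`: the matrix `[0, 2y; 1, 0]`. -/
theorem hasFDerivAt_sqTimeChart (z : Fin 2 → ℝ) :
    HasFDerivAt (fun w : Fin 2 → ℝ => (![w 1 ^ 2, w 0] : Fin 2 → ℝ))
      (LinearMap.toContinuousLinearMap (Matrix.toLin' !![0, 2 * z 1; 1, 0])) z := by
  have h0 : HasFDerivAt (fun w : Fin 2 → ℝ => w 0)
      (ContinuousLinearMap.proj (R := ℝ) (φ := fun _ : Fin 2 => ℝ) 0) z := hasFDerivAt_apply 0 z
  have h1 : HasFDerivAt (fun w : Fin 2 → ℝ => w 1)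
      (ContinuousLinearMap.proj (R := ℝ) (φ := fun _ : Fin 2 => ℝ) 1) z := hasFDerivAt_apply 1 z
  refine hasFDerivAt_pi'.mpr fun i => ?_
  fin_cases i
  · refine ((h1.mul h1).congr_fderiv ?_).congr_of_eventuallyEq (Filter.Eventually.of_forall fun w => by
      simp [sq])
    ext v
    simp [Matrix.toLin'_apply, dotProduct, Fin.sum_univ_two]
    ring
  · refine (h0.congr_fderiv ?_).congr_of_eventuallyEq (Filter.Eventually.of_forall fun w => by simp)
    ext v
    simp [Matrix.toLin'_apply, dotProduct, Fin.sum_univ_two]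

/-- `det [0, 2y; 1, 0] = -2y`. -/
theorem det_sqTimeChart (a : ℝ) :
    (LinearMap.toContinuousLinearMap (Matrix.toLin' !![(0:ℝ), 2 * a; 1, 0])).det = -(2 * a) := by
  show LinearMap.det (Matrix.toLin' !![(0:ℝ), 2 * a; 1, 0]) = _
  rw [LinearMap.det_toLin', Matrix.det_fin_two_of]
  ring

/-- `(t,y) ↦ (y², t)` is injective on the open square. -/
theorem sqTimeChart_injOn :
    InjOn (fun w : Fin 2 → ℝ => (![w 1 ^ 2, w 0] : Fin 2 → ℝ))
      {z | (0 < z 0 ∧ z 0 < 1) ∧ (0 < z 1 ∧ z 1 < 1)} := by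
  intro z hz w hw h
  have h0 := congr_fun h 0
  have h1 := congr_fun h 1
  simp only [Matrix.cons_val_zero, Matrix.cons_val_one] at h0 h1
  have hy : z 1 = w 1 := (pow_left_inj₀ hz.2.1.le hw.2.1.le (by norm_num : (2:ℕ) ≠ 0)).1 h0
  ext i
  fin_cases i
  · exact h1
  · exact hy

/-- `(t,y) ↦ (y², t)` maps the open square onto itself. -/
theorem sqTimeChart_image :
    (fun w : Fin 2 → ℝ => (![w 1 ^ 2, w 0] : Fin 2 → ℝ)) '' {z | (0 < z 0 ∧ z 0 < 1) ∧ (0 < z 1 ∧ z 1 < 1)} =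
      {z | (0 < z 0 ∧ z 0 < 1) ∧ (0 < z 1 ∧ z 1 < 1)} := by
  ext x
  simp only [mem_image, mem_setOf_eq]
  constructor
  · rintro ⟨z, ⟨ht, hy⟩, rfl⟩
    refine ⟨⟨by simp only [Matrix.cons_val_zero]; exact pow_pos hy.1 2, ?_⟩, by simpa using ht⟩
    simp only [Matrix.cons_val_zero]
    nlinarith [hy.1, hy.2]
  · rintro ⟨hw, hτ⟩
    refine ⟨![x 1, Real.sqrt (x 0)], ⟨by simpa using hτ, ⟨by simpa using Real.sqrt_pos.2 hw.1, ?_⟩⟩, ?_⟩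
    · show (![x 1, Real.sqrt (x 0)] : Fin 2 → ℝ) 1 < 1
      simp only [Matrix.cons_val_one]
      exact (Real.sqrt_lt' one_pos).2 (by simpa using hw.2)
    · ext i
      fin_cases i
      · show (![x 1, Real.sqrt (x 0)] : Fin 2 → ℝ) 1 ^ 2 = x 0
        simp only [Matrix.cons_val_one]
        exact Real.sq_sqrt hw.1.le
      · simp

/-! ## `T₂` -/

/-- `4/√3` is algebraic. -/
theorem isAlgebraic_four_div_sqrt_three : IsAlgebraic ℚ (4 / Real.sqrt 3) := by
  have h4 : IsAlgebraic ℚ (4:ℝ) := by simpa using isAlgebraic_nat (R := ℚ) (A := ℝ) 4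
  rw [div_eq_mul_inv]
  exact h4.mul isAlgebraic_sqrt_three.inv

/-- **`T₂` exists and `(4/√3)·Trep ∼ T₂`**: with `Trep = [(0,1)² ∋ (t,y), t^{-1/3}(1-t)^{-2/3}(1-y²t)^{-1/3}]`
(pinned, as a function) the representation
`T₂ = [(0,1)² ∋ (w,τ), (2/√3)·τ^{-1/3}(1-τ)^{-2/3}(1-wτ)^{-1/3}/√w]` exists (integrability transported
along `(t,y) ↦ (y²,t)`) and `(4/√3)·Trep ∼ T₂` is ONE change of variables (rule (2)):
`|det| = 2y` and `(2/√3)·K(t,y)/√(y²) · 2y = (4/√3)·K(t,y)`. [Kontsevich–Zagier 2001, §1.2 rule (2)] -/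
theorem exists_T2 (T : IntegralRep 2) (hTd : T.domain = {z | (0 < z 0 ∧ z 0 < 1) ∧ (0 < z 1 ∧ z 1 < 1)})
    (hTi : T.integrand = fun z => z 0 ^ (-(1:ℝ) / 3) * (1 - z 0) ^ (-(2:ℝ) / 3) * (1 - z 1 ^ 2 * z 0) ^ (-(1:ℝ) / 3)) :
    ∃ T₂ : IntegralRep 2, T₂.domain = {z | (0 < z 0 ∧ z 0 < 1) ∧ (0 < z 1 ∧ z 1 < 1)} ∧
      T₂.integrand = (fun z => 2 / Real.sqrt 3 * (z 1 ^ (-(1:ℝ) / 3) * (1 - z 1) ^ (-(2:ℝ) / 3) *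
        (1 - z 0 * z 1) ^ (-(1:ℝ) / 3)) / Real.sqrt (z 0)) ∧
      Equivalent (T.constMul (4 / Real.sqrt 3) isAlgebraic_four_div_sqrt_three) T₂ := by
  set S2 : Set (Fin 2 → ℝ) := {z | (0 < z 0 ∧ z 0 < 1) ∧ (0 < z 1 ∧ z 1 < 1)} with hS2
  set S := T.constMul (4 / Real.sqrt 3) isAlgebraic_four_div_sqrt_three with hS
  set f : (Fin 2 → ℝ) → ℝ := fun z => 2 / Real.sqrt 3 * (z 1 ^ (-(1:ℝ) / 3) * (1 - z 1) ^ (-(2:ℝ) / 3) *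
    (1 - z 0 * z 1) ^ (-(1:ℝ) / 3)) / Real.sqrt (z 0) with hf
  set Λ : (Fin 2 → ℝ) → (Fin 2 → ℝ) := fun w => (![w 1 ^ 2, w 0] : Fin 2 → ℝ) with hΛ
  set Λ' : (Fin 2 → ℝ) → (Fin 2 → ℝ) →L[ℝ] (Fin 2 → ℝ) := fun z =>
    LinearMap.toContinuousLinearMap (Matrix.toLin' !![0, 2 * z 1; 1, 0]) with hΛ'
  have hS2s : IsSemialgebraic ℚ S2 :=
    ((KZ.isSemialgebraic_setOf_const_lt_apply isAlgebraic_zero 0).inter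
      (KZ.isSemialgebraic_setOf_apply_lt_const isAlgebraic_one 0)).inter
      ((KZ.isSemialgebraic_setOf_const_lt_apply isAlgebraic_zero 1).inter
      (KZ.isSemialgebraic_setOf_apply_lt_const isAlgebraic_one 1))
  have hSd : S.domain = S2 := by rw [hS, IntegralRep.domain_constMul, hTd]
  have hmulpos : ∀ z ∈ S2, 0 < 1 - z 0 * z 1 := fun z hz => by
    nlinarith [mul_lt_mul'' hz.1.2 hz.2.2 hz.1.1.le hz.2.1.le]
  -- the integrand of `T₂` is semialgebraic
  have hfs : IsSemialgebraicFunOn ℚ S2 f := by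
    have hc : IsSemialgebraicFunOn ℚ S2 (fun _ => 2 / Real.sqrt 3) :=
      isSemialgebraicFunOn_const_of_isAlgebraic hS2s isAlgebraic_two_div_sqrt_three
    have hX0 : IsSemialgebraicFunOn ℚ S2 (fun z => z 0) :=
      (isSemialgebraicFunOn_aeval hS2s (X 0 : MvPolynomial (Fin 2) ℚ)).congr fun z _ => by simp
    have hX1 : IsSemialgebraicFunOn ℚ S2 (fun z => z 1) :=
      (isSemialgebraicFunOn_aeval hS2s (X 1 : MvPolynomial (Fin 2) ℚ)).congr fun z _ => by simp
    have h1X1 : IsSemialgebraicFunOn ℚ S2 (fun z => 1 - z 1) :=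
      (isSemialgebraicFunOn_aeval hS2s (1 - X 1 : MvPolynomial (Fin 2) ℚ)).congr fun z _ => by simp
    have hW : IsSemialgebraicFunOn ℚ S2 (fun z => 1 - z 0 * z 1) :=
      (isSemialgebraicFunOn_aeval hS2s (1 - X 0 * X 1 : MvPolynomial (Fin 2) ℚ)).congr fun z _ => by simp
    have hf1 := IsSemialgebraicFunOn.rpow_ratCast hS2s hX1 (fun z hz => hz.2.1) (-1 / 3)
    have hf2 := IsSemialgebraicFunOn.rpow_ratCast hS2s h1X1 (fun z hz => sub_pos.2 hz.2.2) (-2 / 3)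
    have hf3 := IsSemialgebraicFunOn.rpow_ratCast hS2s hW hmulpos (-1 / 3)
    have hnum : IsSemialgebraicFunOn ℚ S2 (fun z => 2 / Real.sqrt 3 * (z 1 ^ (-(1:ℝ) / 3) *
        (1 - z 1) ^ (-(2:ℝ) / 3) * (1 - z 0 * z 1) ^ (-(1:ℝ) / 3))) := by
      refine (IsSemialgebraicFunOn.mul_holds hc (IsSemialgebraicFunOn.mul_holds
        (IsSemialgebraicFunOn.mul_holds hf1 hf2) hf3)).congr fun z _ => ?_
      norm_num
    exact (hnum.div (IsSemialgebraicFunOn.sqrt_holds hX0) fun z hz => (Real.sqrt_pos.2 hz.1.1).ne').congr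
      fun z _ => rfl
  -- the move data
  have hder : ∀ z ∈ S.domain, HasFDerivWithinAt Λ (Λ' z) S.domain z := fun z _ =>
    (hasFDerivAt_sqTimeChart z).hasFDerivWithinAt
  have hinj : InjOn Λ S.domain := by rw [hSd]; exact sqTimeChart_injOn
  have himage : Λ '' S.domain = S2 := by rw [hSd]; exact sqTimeChart_image
  have hsa : IsSemialgebraicMapOn ℚ S.domain Λ := by
    refine IsSemialgebraicMapOn.of_forall S.isSemialgebraic_domain fun j => ?_
    fin_cases j
    · exact (isSemialgebraicFunOn_aeval S.isSemialgebraic_domain (X 1 ^ 2 : MvPolynomial (Fin 2) ℚ)).congr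
        fun z _ => by simp [hΛ]
    · exact (isSemialgebraicFunOn_aeval S.isSemialgebraic_domain (X 0 : MvPolynomial (Fin 2) ℚ)).congr
        fun z _ => by simp [hΛ]
  have hint : ∀ z ∈ S.domain, S.integrand z = f (Λ z) * |(Λ' z).det| := by
    intro z hz
    rw [hSd] at hz
    obtain ⟨⟨ht0, ht1⟩, ⟨hy0, hy1⟩⟩ := hz
    rw [hS, IntegralRep.integrand_constMul, hTi, hΛ', det_sqTimeChart, abs_neg, abs_of_pos (by positivity)]
    simp only [hf, hΛ, Matrix.cons_val_zero, Matrix.cons_val_one]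
    rw [Real.sqrt_sq hy0.le]
    have h3 : Real.sqrt 3 ≠ 0 := (Real.sqrt_pos.2 (by norm_num)).ne'
    field_simp
    ring
  obtain ⟨T₂, h2d, h2i⟩ := exists_rep_of_image S Λ Λ' hder hinj hS2s himage f hfs hint
  refine ⟨T₂, h2d, h2i, ?_⟩
  exact changeOfVariablesRel_subset_relations
    ⟨2, S, T₂, Λ, Λ', hsa, hder, hinj, by rw [h2d, himage], fun z hz => by rw [h2i]; exact hint z hz, rfl⟩

end Summit.KontsevichZagierPeriods.KontsevichZagierPeriods.Theorems.GKZLevelThree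

end
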